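import Summits.PneNP.PneNP.Theorems.ConvexRankGatesLinAlgGateBlindGRankDecoupled
import Summits.PneNP.PneNP.Theorems.ConvexRankGatesLinAlgGateBlindSGGRankCalibration

/-!
# Route ConvexRankGates, crux `LinAlgGateBlind` (stmt-PneNP-10681): an unconditional determinantal-complexity lower bound for the clique polynomial through the GRANK door

Support theorems for the crux (vocabulary of `Theorems/ConvexRankGatesLinAlgGateBlindDefs.lean`). The disprover's
calibration `sgAt_gRank_dc_lowerBound` (`…SGGRankCalibration`) reads the single-gate statement for `GRANK_s` term gates
as a determinantal-complexity lower bound: an affine determinantal representation `det A = CL_{m,k}` of size `≤ s` makes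
`CLIQUE(m,k)` itself ONE `GRANK_s` term gate over edge atoms, which no small-clique DNF approximates. At gate dimension
`m^c` this made the stub Valiant-hard; at the SMALL dimensions where the span cover proves the single-gate statement
outright (`sgAt_gRank_logWidth`, `…GRankLogWidth`: all `s² ≤ m^{7/8}/(log₂ m)^5`, any field) it yields, with no
hypothesis left:

* `not_hasDetRepr_cliquePoly_logWidth` — over EVERY field `F`, eventually in `m`, the clique polynomial
  `CL_{m,⌈m^{1/8}⌉} = ∑_{|T| = ⌈m^{1/8}⌉} ∏_{e ⊆ T} X_e` (tree: `Negative.cliquePoly`) has NO affine determinantal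
  representation of any size `s` with `s² ≤ m^{7/8}/(log₂ m)^5`;
* `not_hasDetRepr_cliquePoly_rpow` — in particular none of size `⌊m^γ⌋` for any fixed `γ < 7/16`:
  `dc_F(CL_{m,⌈m^{1/8}⌉}) > m^{7/16 - o(1)}`.

The bound is polynomial (the conjectured truth is superpolynomial, `CL` being VNP-complete) but exceeds the degree bound
`dc ≥ deg CL = C(⌈m^{1/8}⌉, 2) ≈ m^{1/4}/2`, holds uniformly over all fields and characteristics, and is obtained purely
combinatorially (planting + span cover + the one-gate calibration). Sources: Valiant 1979 (universality of the
determinant); Razborov 1985, Alon–Boppana 1987 §3; the calibration and the covers are the tree's. No new definitions.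
[folklore]
-/

-- `Summit.PneNP.PneNP.…` duplicates `PneNP` BY DESIGN (single-problem summit).
set_option linter.dupNamespace false

noncomputable section

namespace Summit.PneNP.PneNP.Theorems

open Finset Filter Literature.Computability.Complexity Razborov
open Summit.PneNP.PneNP.Cruxes.LinAlgGateBlind.DnfInvariantWideGatesSeeSmallCliques
open Summit.PneNP.PneNP.Cruxes.LinAlgGateBlind.DnfInvariantWideGatesSeeSmallCliques.DenseRegime

/-- **No affine determinantal representation of `CL_{m,⌈m^{1/8}⌉}` of size `s` with `s² ≤ m^{7/8}/(log₂ m)^5`, over any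
field (unconditional).** For every field `F`, eventually in `m`, for every such `s`:
`¬ HasDetRepr (CL_{m, kOf m}) s`. Proof: the calibration `sgAt_gRank_dc_lowerBound` at level `c = 0` and logarithmic width
`L = 8(⌊log₂ m⌋+1)` — its side conditions `2 ≤ L`, `2 ≤ k ≤ m`, `0 ≤ q ≤ 1`, `ε ≤ 1/16 < 1`,
`Pr[CLIQUE] + ε ≤ 1/4 + 1/16 < 1/2 ≤ q^{C(L,2)}` are the dense-regime facts (`denseRegime_level`) — fed with the GRANK door
`sgAt_gRank_logWidth 0`. [folklore] -/
theorem not_hasDetRepr_cliquePoly_logWidth : ∀ (F : Type) [Field F], ∀ᶠ m : ℕ in atTop, ∀ s : ℕ,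
    (s : ℝ) ^ 2 ≤ (m : ℝ) ^ (7 / 8 : ℝ) / Real.logb 2 m ^ 5 →
    ¬ Literature.Computability.AlgebraicComplexity.HasDetRepr
        (Summit.PneNP.PneNP.Theorems.LinAlgGateBlind.Negative.cliquePoly m F (kOf m)) s := by
  intro F _
  filter_upwards [sgAt_gRank_logWidth 0, denseRegime_level 0, logWidth_le_lOf 0, logWidthPerm_regime 0]
    with m hSG hD hLl hR s hs
  obtain ⟨-, -, hc3, -, -⟩ := hR
  have hL8 : 2 * 0 + 8 ≤ (2 * 0 + 8) * (Nat.log 2 m + 1) := Nat.le_mul_of_pos_right _ (Nat.succ_pos _)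
  obtain ⟨hl2, -, hkm, hq0, hq1, -, -, heps, hclq, hhalf⟩ := hD _ hL8 hLl
  have hx2 : (2 : ℝ) ≤ (m : ℝ) ^ (1 / 16 : ℝ) := by push_cast at hc3; linarith
  have hlk := lOf_add_one_le_kOf hx2
  have hk2 : 2 ≤ kOf m := by omega
  have hε : epsOf 0 m ≤ 1 / 16 := by simpa using heps
  exact sgAt_gRank_dc_lowerBound m _ (kOf m) s s (qOf m) (epsOf 0 m) F hl2 hk2 hkm hq0 hq1 (by linarith)
    (by linarith) le_rfl (hSG s hs)

/-- **`dc_F(CL_{m,⌈m^{1/8}⌉}) > m^γ` for every field `F` and every `γ < 7/16`, eventually in `m` (unconditional):** the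
clique polynomial `CL_{m,⌈m^{1/8}⌉}` has no affine determinantal representation of size `⌊m^γ⌋`. (`kOf m = ⌈m^{1/8}⌉` by
definition; `⌊m^γ⌋² ≤ m^{7/8}/(log₂ m)^5` eventually, `eventually_floor_rpow_sq_le`.) [folklore] -/
theorem not_hasDetRepr_cliquePoly_rpow : ∀ (F : Type) [Field F] (γ : ℝ), γ < 7 / 16 → ∀ᶠ m : ℕ in atTop,
    ¬ Literature.Computability.AlgebraicComplexity.HasDetRepr
        (Summit.PneNP.PneNP.Theorems.LinAlgGateBlind.Negative.cliquePoly m F ⌈(m : ℝ) ^ (1 / 8 : ℝ)⌉₊)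
        ⌊(m : ℝ) ^ γ⌋₊ := by
  intro F _ γ hγ
  filter_upwards [not_hasDetRepr_cliquePoly_logWidth F, eventually_floor_rpow_sq_le hγ] with m hm hs
  exact hm _ hs

end Summit.PneNP.PneNP.Theorems

end
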